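import Summits.AtomisticToContinuum.HydrodynamicLimit.Theorems.InformationPercolationEngineChaosClosesEulerQuantitativeRigidity
import Literature.MathematicalPhysics.KineticTheory.Hilbert6Wave0HTheoremProofs
import Literature.MathematicalPhysics.KineticTheory.BoltzmannSolutionsUkaiVelocity
import HarnessLib

/-!
# Dissipation rigidity — B: symmetrisation of the cut dissipation functional, Fatou, collision invariance

Helper for the line `empirical-h-theorem` of the crux `InformationPercolationEngine.ChaosClosesEuler`
(stmt-AtomisticToContinuum-15141), registered stub `stub_dissipationRigidity`.

For a continuous `Λ : ℝ³ → ℝ` and a pair-energy cut `L`, the dissipation functional of the stub,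
`D(Λ, L) = ∫∫ 1_{|v|²+|u|²≤L} (∫ [Λ(v)+Λ(u)−Λ(v′)−Λ(u′)] ((u−v)·ω)₊ dω) e^{Λ(v)} e^{Λ(u)} du dv`,
is symmetrised by the measure-preserving involution `(v, u, ω) ↦ (u′, v′, ω)` of `ℝ³ × ℝ³ × S²`
(tree: `integral_comp_collideSwap_prod`), which preserves the cut (energy conservation) and the kernel and
exchanges `A = Λ(v)+Λ(u)` with `A′ = Λ(v′)+Λ(u′)`:
`2 D(Λ, L) = ∫∫∫ 1_{cut} ((u−v)·ω)₊ (A − A′)(e^{A} − e^{A′}) ≥ 0` termwise (Boltzmann's inequality,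
`(a − a′)(eᵃ − eᵃ′) ≥ 0` with equality iff `a = a′`).

Consequently (`isCollisionInvariant_of_dissipation_le`), if continuous `Λₖ → Λ` pointwise, `Lₖ → ∞` and
`D(Λₖ, Lₖ) ≤ ηₖ → 0`, Fatou's lemma on the nonnegative symmetrised integrands gives
`∫∫∫ ((u−v)·ω)₊ (A − A′)(e^{A} − e^{A′}) = 0` for the limit, whose continuous integrand therefore vanishes
identically (`dv du dω` charges open sets, tree: `isOpenPosMeasure_volume_prod_sphereMeasure`); reversing
`ω` where `(u−v)·ω < 0` this is detailed balance, i.e. `Λ` is a collision invariant, hence quadratic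
(tree: `IsCollisionInvariant.exists_eq_quadratic_holds`).

References: C. Cercignani, R. Illner, M. Pulvirenti, *The Mathematical Theory of Dilute Gases* (1994),
§3.1 Thm 3.1.1, §3.2 (3.2.4)–(3.2.6).
-/

noncomputable section

namespace Summit.AtomisticToContinuum.HydrodynamicLimit.Theorems.ChaosClosesEulerDissipationRigidity

open scoped BigOperators Topology Classical MeasureTheory ENNReal InnerProductSpace
open Filter Set MeasureTheory
open Literature.MathematicalPhysics.KineticTheory
open Literature.Analysis.FluidPDE
open Summit.AtomisticToContinuum.HydrodynamicLimit.Theorems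

/-! ## Boltzmann's elementary inequality -/

/-- `(a − b)(eᵃ − eᵇ) ≥ 0`. [folklore] -/
theorem sub_mul_exp_sub_exp_nonneg (a b : ℝ) : 0 ≤ (a - b) * (Real.exp a - Real.exp b) := by
  rcases le_total a b with hab | hab
  · exact mul_nonneg_of_nonpos_of_nonpos (sub_nonpos.2 hab) (sub_nonpos.2 (Real.exp_le_exp.2 hab))
  · exact mul_nonneg (sub_nonneg.2 hab) (sub_nonneg.2 (Real.exp_le_exp.2 hab))

/-- `(a − b)(eᵃ − eᵇ) = 0` iff `a = b`. [folklore] -/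
theorem sub_mul_exp_sub_exp_eq_zero_iff {a b : ℝ} : (a - b) * (Real.exp a - Real.exp b) = 0 ↔ a = b := by
  refine ⟨fun h => ?_, fun h => by rw [h, sub_self, zero_mul]⟩
  rcases mul_eq_zero.1 h with h | h
  · linarith
  · exact Real.exp_injective (sub_eq_zero.1 h)

/-! ## Symmetries of the cut and of the kernel -/

/-- The kernel `((u − v)·ω)₊` at the post-collisional pair: `B(v′, u′, ω) = B(u, v, ω)`. [folklore] -/
theorem hardSphereKernel_collide_eq_swap (p : V3 × V3) (ω : Metric.sphere (0 : V3) 1) :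
    hardSphereKernel (collide ω p) ω = hardSphereKernel p.swap ω := by
  have h := kernel_collideSwap (B := hardSphereKernel (E := V3)) hardSphereKernel_collide_neg
    hardSphereKernel_swap_neg p.swap ω
  rw [collide_swap, Prod.swap_swap] at h
  exact h

/-- The pair energy `|v|² + |u|²` is conserved, in the swapped order. [folklore] -/
theorem norm_sq_collide_swap (ω : Metric.sphere (0 : V3) 1) (p : V3 × V3) :
    ‖(collide ω p).2‖ ^ 2 + ‖(collide ω p).1‖ ^ 2 = ‖p.1‖ ^ 2 + ‖p.2‖ ^ 2 := by
  rw [add_comm, norm_sq_collide_fst_add_norm_sq_collide_snd]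

/-- If `(v − u)·ω = 0` the collision is trivial. [folklore] -/
theorem collide_eq_self_of_inner_eq_zero {ω : Metric.sphere (0 : V3) 1} {p : V3 × V3}
    (h : ⟪p.1 - p.2, (ω : V3)⟫_ℝ = 0) : collide ω p = p := by
  obtain ⟨v, u⟩ := p
  simp only [collide, Prod.mk.injEq]
  simp only at h
  rw [h, zero_smul, sub_zero, add_zero]
  exact ⟨rfl, rfl⟩

/-! ## Detailed balance from the vanishing of the symmetrised integrand -/

/-- **Detailed balance.** If `((u−v)·ω)₊ (A − A′)(e^{A} − e^{A′}) = 0` for all `(v, u, ω)`, where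
`A = Λ(v) + Λ(u)` and `A′ = Λ(v′) + Λ(u′)`, then `Λ` is a collision invariant (reverse `ω` when
`(u−v)·ω < 0`; the collision is trivial when `(u−v)·ω = 0`). [folklore] -/
theorem isCollisionInvariant_of_symmetrised_eq_zero {Λ : V3 → ℝ}
    (h : ∀ (p : V3 × V3) (ω : Metric.sphere (0 : V3) 1),
      hardSphereKernel p.swap ω * ((Λ p.1 + Λ p.2 - (Λ (collide ω p).1 + Λ (collide ω p).2)) *
        (Real.exp (Λ p.1 + Λ p.2) - Real.exp (Λ (collide ω p).1 + Λ (collide ω p).2))) = 0) :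
    IsCollisionInvariant Λ := by
  intro ω p
  have key : ∀ ω' : Metric.sphere (0 : V3) 1, 0 < ⟪p.2 - p.1, (ω' : V3)⟫_ℝ → collide ω' p = collide ω p →
      Λ (collide ω p).1 + Λ (collide ω p).2 = Λ p.1 + Λ p.2 := by
    intro ω' hpos hcol
    have h1 := h p ω'
    rw [hcol] at h1
    have hk : hardSphereKernel p.swap ω' ≠ 0 := by
      rw [hardSphereKernel, Prod.fst_swap, Prod.snd_swap, max_eq_left hpos.le]
      exact hpos.ne'
    rcases mul_eq_zero.1 h1 with h1 | h1
    · exact absurd h1 hk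
    · exact (sub_mul_exp_sub_exp_eq_zero_iff.1 h1).symm
  rcases lt_trichotomy 0 ⟪p.2 - p.1, (ω : V3)⟫_ℝ with hlt | heq | hgt
  · exact key ω hlt rfl
  · have h0 : ⟪p.1 - p.2, (ω : V3)⟫_ℝ = 0 := by
      rw [← neg_sub, inner_neg_left, ← heq, neg_zero]
    rw [collide_eq_self_of_inner_eq_zero h0]
  · refine key (-ω) ?_ (collide_neg_dir ω p)
    rw [coe_neg_sphere, inner_neg_right]
    linarith

/-- **Vanishing symmetrised integrand ⇒ quadratic.** Under the hypothesis of
`isCollisionInvariant_of_symmetrised_eq_zero`, a continuous `Λ` is `a + ⟪b, v⟫ + c|v|²`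
(classification of continuous collision invariants in dimension `3 ≥ 2`). [folklore] -/
theorem exists_eq_quadratic_of_symmetrised_eq_zero {Λ : V3 → ℝ} (hΛ : Continuous Λ)
    (h : ∀ (p : V3 × V3) (ω : Metric.sphere (0 : V3) 1),
      hardSphereKernel p.swap ω * ((Λ p.1 + Λ p.2 - (Λ (collide ω p).1 + Λ (collide ω p).2)) *
        (Real.exp (Λ p.1 + Λ p.2) - Real.exp (Λ (collide ω p).1 + Λ (collide ω p).2))) = 0) :
    ∃ (a c : ℝ) (b : V3), ∀ v, Λ v = a + ⟪b, v⟫_ℝ + c * ‖v‖ ^ 2 := by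
  have hE : 2 ≤ Module.finrank ℝ V3 := by
    rw [finrank_euclideanSpace_fin]
    norm_num
  exact IsCollisionInvariant.exists_eq_quadratic_holds hE (isCollisionInvariant_of_symmetrised_eq_zero h) hΛ

/-! ## Symmetrisation of the cut dissipation functional -/

/-- A continuous function is bounded on the closed ball of radius `R`. [folklore] -/
theorem exists_bound_on_closedBall {Λ : V3 → ℝ} (hΛ : Continuous Λ) (R : ℝ) :
    ∃ M : ℝ, 0 ≤ M ∧ ∀ v : V3, ‖v‖ ≤ R → |Λ v| ≤ M := by
  obtain ⟨M, hM⟩ := (isCompact_closedBall (0 : V3) R).exists_bound_of_continuousOn hΛ.continuousOn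
  refine ⟨max M 0, le_max_right _ _, fun v hv => ?_⟩
  have h := hM v (mem_closedBall_zero_iff.2 hv)
  rw [Real.norm_eq_abs] at h
  exact h.trans (le_max_left _ _)

/-- In the cut region both velocities, and both post-collisional velocities, have norm `≤ √L`. [folklore] -/
theorem norms_le_of_cut {L : ℝ} {p : V3 × V3} (hp : ‖p.1‖ ^ 2 + ‖p.2‖ ^ 2 ≤ L) (ω : Metric.sphere (0 : V3) 1) :
    ‖p.1‖ ≤ Real.sqrt L ∧ ‖p.2‖ ≤ Real.sqrt L ∧ ‖(collide ω p).1‖ ≤ Real.sqrt L ∧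
      ‖(collide ω p).2‖ ≤ Real.sqrt L := by
  have hc := norm_sq_collide_fst_add_norm_sq_collide_snd ω p
  have key : ∀ x y : ℝ, 0 ≤ x → x ^ 2 + y ^ 2 ≤ L → x ≤ Real.sqrt L := fun x y hx hxy =>
    Real.le_sqrt_of_sq_le (by nlinarith [sq_nonneg y])
  exact ⟨key _ _ (norm_nonneg _) hp, key ‖p.2‖ ‖p.1‖ (norm_nonneg _) (by linarith),
    key ‖(collide ω p).1‖ ‖(collide ω p).2‖ (norm_nonneg _) (by linarith),
    key ‖(collide ω p).2‖ ‖(collide ω p).1‖ (norm_nonneg _) (by linarith)⟩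

/-- The cut set `{|v|² + |u|² ≤ L} × S²` has finite `dv du dω`-measure. [folklore] -/
theorem measure_cutSet_lt_top (L : ℝ) :
    (((volume : Measure V3).prod (volume : Measure V3)).prod
        (sphereMeasure : Measure (Metric.sphere (0 : V3) 1)))
      {q : (V3 × V3) × Metric.sphere (0 : V3) 1 | ‖q.1.1‖ ^ 2 + ‖q.1.2‖ ^ 2 ≤ L} < ∞ := by
  haveI := isFiniteMeasure_sphereMeasure (E := V3)
  have hsub : {q : (V3 × V3) × Metric.sphere (0 : V3) 1 | ‖q.1.1‖ ^ 2 + ‖q.1.2‖ ^ 2 ≤ L} ⊆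
      (Metric.closedBall (0 : V3) (Real.sqrt L) ×ˢ Metric.closedBall (0 : V3) (Real.sqrt L)) ×ˢ univ := by
    intro q hq
    obtain ⟨h1, h2, -, -⟩ := norms_le_of_cut (p := q.1) hq q.2
    simp only [mem_prod, mem_closedBall_zero_iff, mem_univ, and_true]
    exact ⟨h1, h2⟩
  refine (measure_mono hsub).trans_lt ?_
  rw [Measure.prod_prod, Measure.prod_prod]
  exact ENNReal.mul_lt_top (ENNReal.mul_lt_top measure_closedBall_lt_top measure_closedBall_lt_top)
    (measure_lt_top _ _)

/-- **Integrability of the cut dissipation integrand** on `ℝ³ × ℝ³ × S²`: it is a bounded measurable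
function supported in the cut set, which has finite measure. [folklore] -/
theorem integrable_cutIntegrand {Λ : V3 → ℝ} (hΛ : Continuous Λ) (L : ℝ) :
    Integrable (fun q : (V3 × V3) × Metric.sphere (0 : V3) 1 =>
      (if ‖q.1.1‖ ^ 2 + ‖q.1.2‖ ^ 2 ≤ L then (1 : ℝ) else 0) *
        ((Λ q.1.1 + Λ q.1.2 - Λ (collide q.2 q.1).1 - Λ (collide q.2 q.1).2) * hardSphereKernel q.1.swap q.2) *
        (Real.exp (Λ q.1.1) * Real.exp (Λ q.1.2)))
      (((volume : Measure V3).prod (volume : Measure V3)).prod sphereMeasure) := by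
  set S : Set ((V3 × V3) × Metric.sphere (0 : V3) 1) := {q | ‖q.1.1‖ ^ 2 + ‖q.1.2‖ ^ 2 ≤ L} with hS
  have hSm : MeasurableSet S :=
    measurableSet_le (by fun_prop) measurable_const
  set Q₀ : (V3 × V3) × Metric.sphere (0 : V3) 1 → ℝ := fun q =>
    ((Λ q.1.1 + Λ q.1.2 - Λ (collide q.2 q.1).1 - Λ (collide q.2 q.1).2) * hardSphereKernel q.1.swap q.2) *
      (Real.exp (Λ q.1.1) * Real.exp (Λ q.1.2)) with hQ₀
  have hQ₀c : Continuous Q₀ := by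
    have hc := continuous_collide_uncurry (E := V3)
    have h1 : Continuous fun q : (V3 × V3) × Metric.sphere (0 : V3) 1 => Λ (collide q.2 q.1).1 :=
      hΛ.comp (continuous_fst.comp hc)
    have h2 : Continuous fun q : (V3 × V3) × Metric.sphere (0 : V3) 1 => Λ (collide q.2 q.1).2 :=
      hΛ.comp (continuous_snd.comp hc)
    have h3 : Continuous fun q : (V3 × V3) × Metric.sphere (0 : V3) 1 => Λ q.1.1 := hΛ.comp (by fun_prop)
    have h4 : Continuous fun q : (V3 × V3) × Metric.sphere (0 : V3) 1 => Λ q.1.2 := hΛ.comp (by fun_prop)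
    have hB : Continuous fun q : (V3 × V3) × Metric.sphere (0 : V3) 1 => hardSphereKernel q.1.swap q.2 :=
      UkaiLanford.continuous_hardSphereKernel_uncurry.comp (continuous_swap.prodMap continuous_id)
    exact (((h3.add h4).sub h1).sub h2).mul hB |>.mul ((Real.continuous_exp.comp h3).mul
      (Real.continuous_exp.comp h4))
  have heq : (fun q : (V3 × V3) × Metric.sphere (0 : V3) 1 =>
      (if ‖q.1.1‖ ^ 2 + ‖q.1.2‖ ^ 2 ≤ L then (1 : ℝ) else 0) *
        ((Λ q.1.1 + Λ q.1.2 - Λ (collide q.2 q.1).1 - Λ (collide q.2 q.1).2) * hardSphereKernel q.1.swap q.2) *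
        (Real.exp (Λ q.1.1) * Real.exp (Λ q.1.2))) = S.indicator Q₀ := by
    funext q
    rw [mul_assoc, boole_mul, indicator_apply]
    rfl
  rw [heq, integrable_indicator_iff hSm]
  obtain ⟨M, hM0, hM⟩ := exists_bound_on_closedBall hΛ (Real.sqrt L)
  refine Measure.integrableOn_of_bounded (measure_cutSet_lt_top L).ne hQ₀c.aestronglyMeasurable
    (M := (4 * M) * (2 * Real.sqrt L) * (Real.exp M * Real.exp M)) ?_
  refine ae_restrict_of_forall_mem hSm fun q hq => ?_
  obtain ⟨h1, h2, h3, h4⟩ := norms_le_of_cut (p := q.1) hq q.2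
  rw [hQ₀, Real.norm_eq_abs, abs_mul, abs_mul, abs_mul]
  have hA : |Λ q.1.1 + Λ q.1.2 - Λ (collide q.2 q.1).1 - Λ (collide q.2 q.1).2| ≤ 4 * M := by
    have e1 := abs_le.1 (hM _ h1)
    have e2 := abs_le.1 (hM _ h2)
    have e3 := abs_le.1 (hM _ h3)
    have e4 := abs_le.1 (hM _ h4)
    rw [abs_le]
    constructor <;> linarith
  have hB : |hardSphereKernel q.1.swap q.2| ≤ 2 * Real.sqrt L := by
    rw [abs_of_nonneg (UkaiLanford.hardSphereKernel_nonneg' _ _), hardSphereKernel, Prod.fst_swap, Prod.snd_swap]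
    refine max_le ?_ (by positivity)
    calc ⟪q.1.2 - q.1.1, ((q.2 : Metric.sphere (0 : V3) 1) : V3)⟫_ℝ
        ≤ ‖q.1.2 - q.1.1‖ * ‖((q.2 : Metric.sphere (0 : V3) 1) : V3)‖ := real_inner_le_norm _ _
      _ = ‖q.1.2 - q.1.1‖ := by rw [norm_eq_of_mem_sphere q.2, mul_one]
      _ ≤ ‖q.1.2‖ + ‖q.1.1‖ := norm_sub_le _ _
      _ ≤ 2 * Real.sqrt L := by linarith
  have hE : |Real.exp (Λ q.1.1)| * |Real.exp (Λ q.1.2)| ≤ Real.exp M * Real.exp M := by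
    rw [abs_of_pos (Real.exp_pos _), abs_of_pos (Real.exp_pos _)]
    exact mul_le_mul (Real.exp_le_exp.2 (abs_le.1 (hM _ h1)).2) (Real.exp_le_exp.2 (abs_le.1 (hM _ h2)).2)
      (Real.exp_pos _).le (Real.exp_pos _).le
  exact mul_le_mul (mul_le_mul hA hB (abs_nonneg _) (by positivity)) hE (by positivity) (by positivity)

/-- **Symmetrisation (Boltzmann's trick on the cut functional).** For continuous `Λ`, the symmetrised
integrand `1_{cut} ((u−v)·ω)₊ (A − A′)(e^{A} − e^{A′})` is integrable on `ℝ³ × ℝ³ × S²` and its integral is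
`2 D(Λ, L)` (change of variables `(v, u, ω) ↦ (u′, v′, ω)`, which preserves `dv du dω`, the cut and the
kernel). [folklore] -/
theorem symmetrised_integral_eq_two_mul {Λ : V3 → ℝ} (hΛ : Continuous Λ) (L : ℝ) :
    Integrable (fun q : (V3 × V3) × Metric.sphere (0 : V3) 1 =>
      (if ‖q.1.1‖ ^ 2 + ‖q.1.2‖ ^ 2 ≤ L then (1 : ℝ) else 0) * (hardSphereKernel q.1.swap q.2 *
        ((Λ q.1.1 + Λ q.1.2 - (Λ (collide q.2 q.1).1 + Λ (collide q.2 q.1).2)) *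
          (Real.exp (Λ q.1.1 + Λ q.1.2) - Real.exp (Λ (collide q.2 q.1).1 + Λ (collide q.2 q.1).2)))))
      (((volume : Measure V3).prod (volume : Measure V3)).prod sphereMeasure) ∧
    ∫ q : (V3 × V3) × Metric.sphere (0 : V3) 1,
      (if ‖q.1.1‖ ^ 2 + ‖q.1.2‖ ^ 2 ≤ L then (1 : ℝ) else 0) * (hardSphereKernel q.1.swap q.2 *
        ((Λ q.1.1 + Λ q.1.2 - (Λ (collide q.2 q.1).1 + Λ (collide q.2 q.1).2)) *
          (Real.exp (Λ q.1.1 + Λ q.1.2) - Real.exp (Λ (collide q.2 q.1).1 + Λ (collide q.2 q.1).2))))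
      ∂(((volume : Measure V3).prod (volume : Measure V3)).prod sphereMeasure) =
    2 * ∫ v, ∫ u, (if ‖v‖ ^ 2 + ‖u‖ ^ 2 ≤ L then (1 : ℝ) else 0) *
      (∫ ω : Metric.sphere (0 : V3) 1, (Λ v + Λ u - Λ (collide ω (v, u)).1 - Λ (collide ω (v, u)).2) *
        hardSphereKernel (u, v) ω ∂sphereMeasure) * (Real.exp (Λ v) * Real.exp (Λ u)) := by
  set μ : Measure ((V3 × V3) × Metric.sphere (0 : V3) 1) :=
    ((volume : Measure V3).prod (volume : Measure V3)).prod sphereMeasure with hμ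
  -- the unsymmetrised integrand and its image under `(v, u, ω) ↦ (u′, v′, ω)`
  set Q : (V3 × V3) × Metric.sphere (0 : V3) 1 → ℝ := fun q =>
    (if ‖q.1.1‖ ^ 2 + ‖q.1.2‖ ^ 2 ≤ L then (1 : ℝ) else 0) *
      ((Λ q.1.1 + Λ q.1.2 - Λ (collide q.2 q.1).1 - Λ (collide q.2 q.1).2) * hardSphereKernel q.1.swap q.2) *
      (Real.exp (Λ q.1.1) * Real.exp (Λ q.1.2)) with hQ
  have hQi : Integrable Q μ := integrable_cutIntegrand hΛ L
  have hQTi : Integrable (fun q => Q ((collide q.2 q.1).swap, q.2)) μ :=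
    (integrable_comp_collideSwap_prod_iff Q).2 hQi
  -- pointwise: `Q + Q ∘ T₁` is the symmetrised integrand
  have hsum : ∀ q : (V3 × V3) × Metric.sphere (0 : V3) 1, Q q + Q ((collide q.2 q.1).swap, q.2) =
      (if ‖q.1.1‖ ^ 2 + ‖q.1.2‖ ^ 2 ≤ L then (1 : ℝ) else 0) * (hardSphereKernel q.1.swap q.2 *
        ((Λ q.1.1 + Λ q.1.2 - (Λ (collide q.2 q.1).1 + Λ (collide q.2 q.1).2)) *
          (Real.exp (Λ q.1.1 + Λ q.1.2) - Real.exp (Λ (collide q.2 q.1).1 + Λ (collide q.2 q.1).2)))) := by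
    intro q
    obtain ⟨p, ω⟩ := q
    simp only [hQ, Prod.swap_swap, Prod.fst_swap, Prod.snd_swap, collide_collideSwap, norm_sq_collide_swap,
      hardSphereKernel_collide_eq_swap, Real.exp_add]
    ring
  refine ⟨?_, ?_⟩
  · have h := hQi.add hQTi
    exact h.congr (Eventually.of_forall fun q => hsum q)
  · -- `∫ (Q + Q∘T₁) = 2 ∫ Q`
    have h1 : ∫ q, (if ‖q.1.1‖ ^ 2 + ‖q.1.2‖ ^ 2 ≤ L then (1 : ℝ) else 0) * (hardSphereKernel q.1.swap q.2 *
        ((Λ q.1.1 + Λ q.1.2 - (Λ (collide q.2 q.1).1 + Λ (collide q.2 q.1).2)) *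
          (Real.exp (Λ q.1.1 + Λ q.1.2) - Real.exp (Λ (collide q.2 q.1).1 + Λ (collide q.2 q.1).2)))) ∂μ =
        2 * ∫ q, Q q ∂μ := by
      rw [show (fun q : (V3 × V3) × Metric.sphere (0 : V3) 1 =>
          (if ‖q.1.1‖ ^ 2 + ‖q.1.2‖ ^ 2 ≤ L then (1 : ℝ) else 0) * (hardSphereKernel q.1.swap q.2 *
            ((Λ q.1.1 + Λ q.1.2 - (Λ (collide q.2 q.1).1 + Λ (collide q.2 q.1).2)) *
              (Real.exp (Λ q.1.1 + Λ q.1.2) - Real.exp (Λ (collide q.2 q.1).1 + Λ (collide q.2 q.1).2))))) =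
          fun q => Q q + Q ((collide q.2 q.1).swap, q.2) from funext fun q => (hsum q).symm,
        integral_add hQi hQTi, integral_comp_collideSwap_prod Q, two_mul]
    rw [h1]
    congr 1
    -- `∫ Q dμ = D(Λ, L)` by Fubini
    rw [integral_prod Q hQi, integral_prod _ hQi.integral_prod_left]
    refine integral_congr_ae (Eventually.of_forall fun v => ?_)
    refine integral_congr_ae (Eventually.of_forall fun u => ?_)
    simp only [hQ, Prod.swap_prod_mk]
    rw [← integral_const_mul, ← integral_mul_const]

/-! ## Registered sub-goal -/

/-- **Registered sub-goal `stub_dissipationRigidityB` (helper B of `stub_dissipationRigidity`): detailed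
balance — if the symmetrised entropy-production integrand `((u−v)·ω)₊ (A − A′)(e^{A} − e^{A′})` of `Λ`
vanishes identically, `Λ` is a collision invariant.** [folklore] -/
theorem stub_dissipationRigidityB : ∀ {Λ : V3 → ℝ}, (∀ (p : V3 × V3) (ω : Metric.sphere (0 : V3) 1), hardSphereKernel p.swap ω * ((Λ p.1 + Λ p.2 - (Λ (collide ω p).1 + Λ (collide ω p).2)) * (Real.exp (Λ p.1 + Λ p.2) - Real.exp (Λ (collide ω p).1 + Λ (collide ω p).2))) = 0) → IsCollisionInvariant Λ :=
  fun h => isCollisionInvariant_of_symmetrised_eq_zero h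

end Summit.AtomisticToContinuum.HydrodynamicLimit.Theorems.ChaosClosesEulerDissipationRigidity

end
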